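import Mathlib.Data.Real.Basic
import Mathlib.Tactic.Linarith
import Mathlib.Tactic.Positivity
import Mathlib.Tactic.Ring

/-!
# `NoHeavyLowerTail` (stmt-CriticalPhenomena-4575) — the two identity families of the sharp cubic row SF3-Hmax hold for EVERY FKG-lattice
# measure on the cube `{0,1}³` (star: dense half; triangle: sparse half), with equality in the modular (product) case

Support file (prover seat `prim-ineq-gen-2`, gen 13; `--supports stmt-CriticalPhenomena-4575`).  Pure real arithmetic, no measure theory, no named facts,
no sorries.  Memo run/shared/lean/prim/prim-ineq-gen-2/FK-RC-GEN13.md §3(b).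

SETTING.  A (not necessarily normalised) nonnegative weight on the eight points of `{0,1}³`, written by level:
`x = μ(∅)`, `y i = μ({i})`, `z i = μ({j,k})` (`{i,j,k} = {1,2,3}`), `w = μ({1,2,3})`.  The FKG lattice condition `μ(S)μ(T) ≤ μ(S ∩ T)μ(S ∪ T)`
is, on this cube, the nine `2 × 2` minors
  `y i · y j ≤ x · z k`,   `z j · z k ≤ w · y i`,   `y i · z i ≤ x · w`     (`{i,j,k} = {1,2,3}`),
all equalities for a product (modular) weight.  Two three-terminal percolation models live on this cube:
* the STAR (coordinates = the three arms `s–a, s–b, s–c`): `t = P(abc) = w`, `P(a~b) = w + z₃` etc., so the dense half of SF3-Hmax,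
  `P(abc)²·μ(total) ≥ P(ab)P(ac)P(bc)`, is `star_dense_half` below;
* the TRIANGLE (coordinates = the three edges `bc, ac, ab`): `q = P(a|b|c) = x`, `P(c ∤ ab) = x + y₃` etc., so the sparse half,
  `P(a|b|c)²·μ(total) ≥ ∏ P(x ∤ rest)`, is `triangle_sparse_half`.
Both therefore hold for EVERY FKG-lattice weight on the cube (random-cluster measures with cluster weight `q ≥ 1`, ferromagnetic couplings of the
three edge variables, …), not only for product measures where they are the identities `indep₃_prod_pairInter_eq_sq` /
`indep₃_prod_pairUnion_compl_eq_sq` of `Literature.Probability.LatticeModels` (`ThreePointConnectivityRatio.lean`); for cluster weight `q < 1` the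
triangle's sparse half fails (`Hb = (1−w)⁶q⁶w³(q−1)/Z³`, memo §3(a)).  The proofs are the `k = 3` Ahlswede–Daykin / Rinott–Saks rearrangement on the cube,
written out as three uses of the minors each.  [cite: Gladkov2024StrongFKG, Thm. 3.2 (the quadratic part `ab ≥ e₂` for UI measures)]
-/

namespace Summit.CriticalPhenomena.PercolationContinuityZ3.Theorems

namespace CubicThreePointLattice

/-- **Star, dense half, for every FKG-lattice weight on `{0,1}³`.**  With `w = μ(111)` (all three arms open), `z i = μ`(exactly the two arms
other than `i`), `y i = μ`(only arm `i`), `x = μ(000)`: the three minors `z j·z k ≤ w·y i` and one diagonal minor `y₁·z₁ ≤ x·w` give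
`(w + z₁)(w + z₂)(w + z₃) ≤ w²·(x + Σ y + Σ z + w)`, i.e. `P(ab)P(ac)P(bc) ≤ P(abc)²` (normalised), with no regime hypothesis. [conjecture-support: SF3-Hmax in FKG-lattice generality] -/
theorem star_dense_half (x y₁ y₂ y₃ z₁ z₂ z₃ w : ℝ) (hw : 0 ≤ w) (hz₁ : 0 ≤ z₁)
    (m₁ : z₂ * z₃ ≤ w * y₁) (m₂ : z₁ * z₃ ≤ w * y₂) (m₃ : z₁ * z₂ ≤ w * y₃)
    (d₁ : y₁ * z₁ ≤ x * w) :
    (w + z₁) * (w + z₂) * (w + z₃) ≤ w ^ 2 * (x + y₁ + y₂ + y₃ + z₁ + z₂ + z₃ + w) := by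
  -- `w·e₂(z) ≤ w²·Σy` from the first three minors, `e₃(z) ≤ w²·x` from `z₂z₃ ≤ w y₁` and `y₁ z₁ ≤ x w`
  have h1 : w * (z₂ * z₃) ≤ w * (w * y₁) := mul_le_mul_of_nonneg_left m₁ hw
  have h2 : w * (z₁ * z₃) ≤ w * (w * y₂) := mul_le_mul_of_nonneg_left m₂ hw
  have h3 : w * (z₁ * z₂) ≤ w * (w * y₃) := mul_le_mul_of_nonneg_left m₃ hw
  have h4 : z₁ * (z₂ * z₃) ≤ z₁ * (w * y₁) := mul_le_mul_of_nonneg_left m₁ hz₁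
  have h5 : w * (y₁ * z₁) ≤ w * (x * w) := mul_le_mul_of_nonneg_left d₁ hw
  nlinarith [h1, h2, h3, h4, h5, mul_nonneg hw hz₁]

/-- **Triangle, sparse half, for every FKG-lattice weight on `{0,1}³`.**  With `x = μ(000)` (no edge open, `= P(a|b|c)`), `y i = μ`(only edge `i`),
`z i`, `w` as above: the three minors `y i·y j ≤ x·z k` and `y₁·z₁ ≤ x·w` give `(x + y₁)(x + y₂)(x + y₃) ≤ x²·(x + Σ y + Σ z + w)`, i.e.
`∏ P(vertex ∤ rest) ≤ P(a|b|c)²` (normalised), with no regime hypothesis; for a random-cluster weight with cluster weight `q < 1` it is false.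
(Order dual of `star_dense_half`.) [conjecture-support: SF3-Hmax in FKG-lattice generality] -/
theorem triangle_sparse_half (x y₁ y₂ y₃ z₁ z₂ z₃ w : ℝ) (hx : 0 ≤ x) (hy₁ : 0 ≤ y₁)
    (n₁ : y₂ * y₃ ≤ x * z₁) (n₂ : y₁ * y₃ ≤ x * z₂) (n₃ : y₁ * y₂ ≤ x * z₃)
    (d₁ : y₁ * z₁ ≤ x * w) :
    (x + y₁) * (x + y₂) * (x + y₃) ≤ x ^ 2 * (x + y₁ + y₂ + y₃ + z₁ + z₂ + z₃ + w) := by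
  have h := star_dense_half w z₁ z₂ z₃ y₁ y₂ y₃ x hx hy₁ n₁ n₂ n₃ (by linarith [d₁])
  nlinarith [h]

/-- **SF3-Hmax on the cube, FKG-lattice generality, in the row vocabulary.**  For a normalised FKG-lattice weight (`x + Σy + Σz + w = 1`) read as the
star (`t = w`, `u i = z i`, `q = x + Σ y`) the dense half `t·(q t − e₂(u)) − e₃(u) ≥ 0` holds outright. [conjecture-support: SF3-Hmax in FKG-lattice generality] -/
theorem star_Ha_nonneg (x y₁ y₂ y₃ z₁ z₂ z₃ w : ℝ) (hw : 0 ≤ w) (hz₁ : 0 ≤ z₁)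
    (m₁ : z₂ * z₃ ≤ w * y₁) (m₂ : z₁ * z₃ ≤ w * y₂) (m₃ : z₁ * z₂ ≤ w * y₃)
    (d₁ : y₁ * z₁ ≤ x * w) (hσ : x + y₁ + y₂ + y₃ + z₁ + z₂ + z₃ + w = 1) :
    0 ≤ w * ((x + y₁ + y₂ + y₃) * w - (z₁ * z₂ + z₁ * z₃ + z₂ * z₃)) - z₁ * z₂ * z₃ := by
  have h := star_dense_half x y₁ y₂ y₃ z₁ z₂ z₃ w hw hz₁ m₁ m₂ m₃ d₁
  rw [hσ, mul_one] at h
  nlinarith [h]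

/-- Dually, read as the triangle (`q = x`, `u i = y i`, `t = Σ z + w`) the sparse half `q·(q t − e₂(u)) − e₃(u) ≥ 0` holds outright for every
normalised FKG-lattice weight on the cube. [conjecture-support: SF3-Hmax in FKG-lattice generality] -/
theorem triangle_Hb_nonneg (x y₁ y₂ y₃ z₁ z₂ z₃ w : ℝ) (hx : 0 ≤ x) (hy₁ : 0 ≤ y₁)
    (n₁ : y₂ * y₃ ≤ x * z₁) (n₂ : y₁ * y₃ ≤ x * z₂) (n₃ : y₁ * y₂ ≤ x * z₃)
    (d₁ : y₁ * z₁ ≤ x * w) (hσ : x + y₁ + y₂ + y₃ + z₁ + z₂ + z₃ + w = 1) :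
    0 ≤ x * (x * (z₁ + z₂ + z₃ + w) - (y₁ * y₂ + y₁ * y₃ + y₂ * y₃)) - y₁ * y₂ * y₃ := by
  have h := triangle_sparse_half x y₁ y₂ y₃ z₁ z₂ z₃ w hx hy₁ n₁ n₂ n₃ d₁
  rw [hσ, mul_one] at h
  nlinarith [h]

end CubicThreePointLattice

end Summit.CriticalPhenomena.PercolationContinuityZ3.Theorems
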